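import Summits.AtomisticToContinuum.Crystallization.Theorems.FreeSplittingCertificatesStrictSplittingRuleCoreJointDefs
import Summits.AtomisticToContinuum.Crystallization.Theorems.FreeSplittingCertificatesStrictSplittingRuleCoreFirstOrderDesignGeometry
import Summits.AtomisticToContinuum.Crystallization.Theorems.FreeSplittingCertificatesStrictSplittingRuleFiniteBall
import Summits.AtomisticToContinuum.Crystallization.Theorems.FreeSplittingCertificatesStrictSplittingRuleSummableBare
import Summits.AtomisticToContinuum.Crystallization.Theorems.FreeSplittingCertificatesStrictSplittingRuleSummableTransfer

/-!
# Summability of the co-rotated half-split second variation over the hcp lattice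

Helper of reshape r6 (lead c5) of crux `StrictSplittingRule` (stmt-AtomisticToContinuum-12560), line `registered`:
toward any proof of H12⋆ `CoreJointCoercive` (…CoreJointDefs.lean). Registered stub, landed `--supports stmt-AtomisticToContinuum-12560`.
-/

noncomputable section

namespace Summit.AtomisticToContinuum.Crystallization.Theorems.StrictSplittingRuleBirth

open scoped BigOperators Classical
open Literature.MathematicalPhysics.StatisticalMechanics
open Literature.Geometry.DiscreteGeometry
open Summit.AtomisticToContinuum.Crystallization.Theorems.PalmUnimodularRigidity.LayeredLawsSelectHcp
  (hcpSite ljSqDeriv)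

/-- **Operator bound of a linear self-map of `ℝ³`**: `‖W v‖ ≤ K‖v‖` with `K` the operator norm of the continuous
version `LinearMap.toContinuousLinearMap W` (finite dimension). [folklore] -/
theorem summableCorot_linear_bound (W : EuclideanSpace ℝ (Fin 3) →ₗ[ℝ] EuclideanSpace ℝ (Fin 3)) :
    ∃ K : ℝ, ∀ v, ‖W v‖ ≤ K * ‖v‖ :=
  ⟨‖LinearMap.toContinuousLinearMap W‖, fun v => by
    simpa only [LinearMap.coe_toContinuousLinearMap'] using (LinearMap.toContinuousLinearMap W).le_opNorm v⟩

/-- **The co-rotated far tail term at one site is `O(‖D‖⁻⁶)`**: for `D ≠ 0` and `w, z` in `ℝ³` with `‖z‖ ≤ K‖D‖`,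
`|½(W′(‖D‖²)‖w − z‖² + 2W″(‖D‖²)⟨D, w⟩²)| ≤ ‖w‖²(3‖D‖⁻⁸ + 4‖D‖⁻¹⁴) + K²(‖D‖⁻⁶ + ‖D‖⁻¹²)`, from
`|W′(s)| ≤ ½(s⁻⁴ + s⁻⁷)`, `|W″(s)| ≤ ½(7s⁻⁸ + 4s⁻⁵)`, `‖w − z‖² ≤ 2‖w‖² + 2K²‖D‖²` and Cauchy–Schwarz
`⟨D, w⟩² ≤ ‖D‖²‖w‖²`. [folklore] -/
theorem summableCorot_tail_abs_le (D w z : EuclideanSpace ℝ (Fin 3)) {K : ℝ} (hD : 0 < ‖D‖)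
    (hz : ‖z‖ ≤ K * ‖D‖) :
    |1 / 2 * (ljSqDeriv (‖D‖ ^ 2) * ‖w - z‖ ^ 2 +
        2 * (1 / 2 * (7 * ((‖D‖ ^ 2)⁻¹) ^ 8 - 4 * ((‖D‖ ^ 2)⁻¹) ^ 5)) * (inner ℝ D w) ^ 2)| ≤
      ‖w‖ ^ 2 * 3 * (‖D‖⁻¹) ^ 8 + ‖w‖ ^ 2 * 4 * (‖D‖⁻¹) ^ 14 +
        K ^ 2 * (‖D‖⁻¹) ^ 6 + K ^ 2 * (‖D‖⁻¹) ^ 12 := by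
  have hle : (inner ℝ D w) ^ 2 ≤ ‖D‖ ^ 2 * ‖w‖ ^ 2 := by
    rw [← mul_pow, ← sq_abs]
    exact pow_le_pow_left₀ (abs_nonneg _) (abs_real_inner_le_norm D w) 2
  have hwz : ‖w - z‖ ^ 2 ≤ 2 * ‖w‖ ^ 2 + 2 * (K * ‖D‖) ^ 2 := by
    have h1 : ‖w - z‖ ^ 2 ≤ (‖w‖ + ‖z‖) ^ 2 := pow_le_pow_left₀ (norm_nonneg _) (norm_sub_le w z) 2
    have h2 : ‖z‖ ^ 2 ≤ (K * ‖D‖) ^ 2 := pow_le_pow_left₀ (norm_nonneg z) hz 2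
    nlinarith [h1, h2, sq_nonneg (‖w‖ - ‖z‖)]
  have h2 : (‖D‖ ^ 2)⁻¹ = ‖D‖⁻¹ ^ 2 := by rw [inv_pow]
  unfold ljSqDeriv
  rw [h2]
  set x := ‖D‖⁻¹ with hx
  set N := ‖w‖ ^ 2 with hN
  set M := ‖w - z‖ ^ 2 with hM
  set I := (inner ℝ D w) ^ 2 with hI
  have hx0 : 0 ≤ x := inv_nonneg.2 hD.le
  have hN0 : 0 ≤ N := sq_nonneg _
  have hM0 : 0 ≤ M := sq_nonneg _
  have hI0 : 0 ≤ I := sq_nonneg _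
  have hxD : x ^ 2 * ‖D‖ ^ 2 = 1 := by rw [hx, ← mul_pow, inv_mul_cancel₀ hD.ne', one_pow]
  have h1 : x ^ 2 * I ≤ N := by
    calc x ^ 2 * I ≤ x ^ 2 * (‖D‖ ^ 2 * N) := mul_le_mul_of_nonneg_left hle (pow_nonneg hx0 2)
      _ = N := by rw [← mul_assoc, hxD, one_mul]
  have h3 : x ^ 2 * M ≤ 2 * (x ^ 2 * N) + 2 * K ^ 2 := by
    calc x ^ 2 * M ≤ x ^ 2 * (2 * N + 2 * (K * ‖D‖) ^ 2) := mul_le_mul_of_nonneg_left hwz (pow_nonneg hx0 2)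
      _ = 2 * (x ^ 2 * N) + 2 * K ^ 2 * (x ^ 2 * ‖D‖ ^ 2) := by ring
      _ = 2 * (x ^ 2 * N) + 2 * K ^ 2 := by rw [hxD, mul_one]
  have k1 := mul_nonneg (pow_nonneg hx0 14) (sub_nonneg.2 h1)
  have k2 := mul_nonneg (pow_nonneg hx0 8) (sub_nonneg.2 h1)
  have k3 := mul_nonneg (pow_nonneg hx0 6) (sub_nonneg.2 h3)
  have k4 := mul_nonneg (pow_nonneg hx0 12) (sub_nonneg.2 h3)
  have k5 := mul_nonneg (pow_nonneg hx0 8) hM0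
  have k6 := mul_nonneg (pow_nonneg hx0 14) hM0
  have k7 := mul_nonneg (pow_nonneg hx0 16) hI0
  have k8 := mul_nonneg (pow_nonneg hx0 10) hI0
  have k9 := mul_nonneg (pow_nonneg hx0 8) hN0
  have k10 := mul_nonneg (pow_nonneg hx0 14) hN0
  have k11 := mul_nonneg (pow_nonneg hx0 6) (sq_nonneg K)
  have k12 := mul_nonneg (pow_nonneg hx0 12) (sq_nonneg K)
  rw [abs_le]
  constructor
  · linarith [k1, k2, k3, k4, k5, k6, k7, k8, k9, k10, k11, k12]
  · linarith [k1, k2, k3, k4, k5, k6, k7, k8, k9, k10, k11, k12]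

/-- **stub_summableCorotatedBare** (r6 helper, glue): for a finitely supported `u`, any site `p` and any linear `W`, the
CO-ROTATED naive half-split second-variation series of `CoreJointSiteIneq` is summable over `ℤ³` (cofinitely the summand
is `½W′(s_q)‖−u_p − W(y_q−y_p)‖² + W″(s_q)⟨y_q−y_p, −u_p⟩²` = `O(‖y_q−y_p‖⁻⁶)`; `summableBare_inv_pow_sub` with n = 6, 8,
12, 14). [folklore] -/
theorem stub_summableCorotatedBare : ∀ a h : ℝ, 0 < a → 0 < h →
    ∀ u : ℤ × ℤ × ℤ → EuclideanSpace ℝ (Fin 3), (Function.support u).Finite → ∀ p : ℤ × ℤ × ℤ,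
      ∀ W : EuclideanSpace ℝ (Fin 3) →ₗ[ℝ] EuclideanSpace ℝ (Fin 3),
        Summable fun q : ℤ × ℤ × ℤ => (if q = p then (0 : ℝ) else
          1 / 2 * (ljSqDeriv (‖hcpSite a h q - hcpSite a h p‖ ^ 2) *
              ‖u q - u p - W (hcpSite a h q - hcpSite a h p)‖ ^ 2 +
            2 * (1 / 2 * (7 * ((‖hcpSite a h q - hcpSite a h p‖ ^ 2)⁻¹) ^ 8 -
              4 * ((‖hcpSite a h q - hcpSite a h p‖ ^ 2)⁻¹) ^ 5)) *
              (inner ℝ (hcpSite a h q - hcpSite a h p) (u q - u p)) ^ 2)) := by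
  intro a h ha hh u hu p W
  obtain ⟨K, hK⟩ := summableCorot_linear_bound W
  -- the tail family: `u q` replaced by `0`; dominated by `‖u p‖²(3‖D‖⁻⁸ + 4‖D‖⁻¹⁴) + K²(‖D‖⁻⁶ + ‖D‖⁻¹²)`
  have hT : Summable fun q : ℤ × ℤ × ℤ => (if q = p then (0 : ℝ) else
      1 / 2 * (ljSqDeriv (‖hcpSite a h q - hcpSite a h p‖ ^ 2) *
          ‖-u p - W (hcpSite a h q - hcpSite a h p)‖ ^ 2 +
        2 * (1 / 2 * (7 * ((‖hcpSite a h q - hcpSite a h p‖ ^ 2)⁻¹) ^ 8 -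
          4 * ((‖hcpSite a h q - hcpSite a h p‖ ^ 2)⁻¹) ^ 5)) *
          (inner ℝ (hcpSite a h q - hcpSite a h p) (-u p)) ^ 2)) := by
    have h6 := summableBare_inv_pow_sub ha hh p (show 3 < 6 by norm_num)
    have h8 := summableBare_inv_pow_sub ha hh p (show 3 < 8 by norm_num)
    have h12 := summableBare_inv_pow_sub ha hh p (show 3 < 12 by norm_num)
    have h14 := summableBare_inv_pow_sub ha hh p (show 3 < 14 by norm_num)
    refine Summable.of_norm_bounded
      ((((h8.mul_left (‖-u p‖ ^ 2 * 3)).add (h14.mul_left (‖-u p‖ ^ 2 * 4))).add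
        (h6.mul_left (K ^ 2))).add (h12.mul_left (K ^ 2))) fun q => ?_
    rw [Real.norm_eq_abs]
    by_cases hq : q = p
    · simp [hq]
    · simp only [if_neg hq]
      exact summableCorot_tail_abs_le _ _ _ (summableBare_norm_sub_pos ha hh hq) (hK _)
  -- the full family agrees with the tail family off the finite support of `u`
  refine hT.congr_cofinite (Filter.eventually_cofinite.2 (hu.subset fun q hq => ?_))
  by_contra h0
  rw [Function.mem_support, not_not] at h0
  refine absurd ?_ hq
  simp only [h0, zero_sub]

end Summit.AtomisticToContinuum.Crystallization.Theorems.StrictSplittingRuleBirth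

end
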